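import Summits.FinalStateConjecture.FinalStateConjecture.Theorems.EIHFluxBalanceInertialRecessionStubSlavingCOERSymbolLab
import Summits.FinalStateConjecture.FinalStateConjecture.Theorems.EIHFluxBalanceInertialRecessionSlavingAxisKernel
import Literature.Geometry.Lorentzian.KerrAxialSymmetryCovariant
import Literature.Geometry.Lorentzian.MultiCentreKerrSchild

/-!
# Route EIHFluxBalance — `InertialRecession` (E′), line `SketchCleanExcision`, skeleton r13,
# stub `stub_coerSymbolQuant` (C): the KERNEL of the symbol rows, for every spin

Helper file for the crux `stmt-FinalStateConjecture-17403`
(`Summit.FinalStateConjecture.FinalStateConjecture.Theses.EIHFluxBalance.InertialRecession`, E′),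
registered stub `stub_coerSymbolQuant` (quantitative uniform robust COER-B). This file is the
qualitative kernel step of the compactness argument, for EVERY spin `a` (the tree had it for
`a = 0`, `spatial_eq_zero_of_symbolRows_eq_zero_four_events`):

* `coerSym_lieForm_nullPair` — the rest-frame first variation of the Kerr–Schild form
  `g = η + 2H ℓ ⊗ ℓ` under an infinitesimal Poincaré motion `Z(y) = A y + d` (`A` `η`-skew),
  `∂_{Z(y)} g + g(A·,·) + g(·,A·)`, is a null pair `ℓ ⊗ m + m ⊗ ℓ` with `m(ℓ♯) = 0`
  (`m = (∂_Z H) ℓ + 2H(∂_Z ℓ + ℓ ∘ A)`; `L_Z η = 0`, `(∂_Z ℓ)(ℓ♯) = 0`, `ℓ(Aℓ♯) = η(ℓ♯, Aℓ♯) = 0`);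
* `coerSym_isInvertible_boostedKerrBilin`, `coerSym_sharpAt_boosted_ellLab` — lab raising of the
  boosted null covector, `♯_{G₀(x)}(ℓ ∘ Λ⁻¹) = Λ ℓ♯`, every spin;
* `coerSym_lieForm_eq_zero_of_symbol_eq_zero` — at ONE lab event: if the principal-symbol
  expression `σ_{G₀(x)}(dx⁰)` of the lab first-variation form vanishes (all rows, any trace
  coefficient), the rest-frame first variation vanishes there (kernel lemma
  `eq_zero_of_symbol_nullPair_eq_zero`);
* `coerSym_axisKernel_of_symbol` — at the THREE lab axis events `Λ P_k` of `axisKernel_slab`: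
  vanishing symbol rows force `A e₀ = 0`, `d⃗ = 0` and (`a ≠ 0`) `A e₃ = 0`.

Elementary; no definitions, no named facts, no `sorry`.
-/

set_option linter.dupNamespace false
set_option maxSynthPendingDepth 3

noncomputable section

open Set Function Literature.Geometry.Lorentzian Literature.Geometry.Lorentzian.MetricCoord

namespace Summit.FinalStateConjecture.FinalStateConjecture.Theorems.SublinearIsFree.Slaving

/-! ### The first variation of the Kerr–Schild form is a null pair, every spin -/

section NullPair

/-- `η`-skewness gives `η(u, A u) = 0`. [folklore] -/
theorem coerSym_minkowski_skew_self {A : E4 →L[ℝ] E4}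
    (hA : ∀ u w : E4, Minkowski.bilin (A u) w + Minkowski.bilin u (A w) = 0) (u : E4) :
    Minkowski.bilin u (A u) = 0 := by
  have h := hA u u
  rw [Minkowski.bilin_symm (A u) u] at h
  linarith

/-- `(∑ c_μ dx^μ)(∂_ν) = c_ν`. [folklore] -/
theorem coerSym_covector_basisVector (c : Fin 4 → ℝ) (ν : Fin 4) :
    E4.covector c (E4.basisVector ν) = c ν := by
  fin_cases ν <;> simp [E4.covector_apply, E4.basisVector]

/-- **The first variation of `g_{M,a} = η + 2H ℓ ⊗ ℓ` under an infinitesimal Poincaré motion is a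
null pair, for every spin.** For `r(y) > 0`, `A` `η`-skew and `d ∈ E4` there is a covector `m`
with `m(ℓ♯) = 0` and
`∂_{Ay+d} g(v,w) + g(Av, w) + g(v, Aw) = ℓ(v) m(w) + m(v) ℓ(w)`; explicitly
`m = (∂_Z H) ℓ + 2H (∂_Z ℓ + ℓ ∘ A)`, `Z = Ay + d` (`L_Z η = 0` by skewness; `m(ℓ♯) = 0` from
`ℓ(ℓ♯) = 0`, `(∂_Z ℓ)(ℓ♯) = ½ ∂_Z η(ℓ♯,ℓ♯) = 0` and `ℓ(Aℓ♯) = η(ℓ♯, Aℓ♯) = 0`).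
[cite: KerrSchild1965, §2] -/
theorem coerSym_lieForm_nullPair (M a : ℝ) {y : E4} (hy : 0 < Kerr.radius a y) {A : E4 →L[ℝ] E4}
    (hA : ∀ u w : E4, Minkowski.bilin (A u) w + Minkowski.bilin u (A w) = 0) (d : E4) :
    ∃ m : E4 →L[ℝ] ℝ, m (Kerr.nullVector a y) = 0 ∧ ∀ v w : E4,
      fderiv ℝ (Kerr.bilin M a) y (A y + d) v w + Kerr.bilin M a y (A v) w +
          Kerr.bilin M a y v (A w) =
        Kerr.nullCovector a y v * m w + m v * Kerr.nullCovector a y w := by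
  set Z : E4 := A y + d with hZ
  set DH : ℝ := fderiv ℝ (Kerr.scalarH M a) y Z with hDH
  set dℓ : Fin 4 → ℝ := fun ν ↦ fderiv ℝ (fun x ↦ Kerr.nullCovectorFun a x ν) y Z with hdℓ
  set m : E4 →L[ℝ] ℝ := DH • Kerr.nullCovector a y +
    (2 * Kerr.scalarH M a y) • (E4.covector dℓ + (Kerr.nullCovector a y).comp A) with hm
  have hmapply : ∀ w, m w = DH * Kerr.nullCovector a y w +
      2 * Kerr.scalarH M a y * (E4.covector dℓ w + Kerr.nullCovector a y (A w)) := by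
    intro w
    simp only [hm, add_apply, FunLike.coe_smul, Pi.smul_apply,
      smul_eq_mul, ContinuousLinearMap.comp_apply]
  refine ⟨m, ?_, fun v w ↦ ?_⟩
  · rw [hmapply, Kerr.nullCovector_nullVector hy, mul_zero, zero_add]
    have h1 : E4.covector dℓ (Kerr.nullVector a y) = 0 := by
      rw [E4.covector_apply, ← Kerr.sum_nullVector_mul_fderiv_nullCovectorFun hy Z]
      exact Finset.sum_congr rfl fun μ _ ↦ mul_comm _ _
    have h2 : Kerr.nullCovector a y (A (Kerr.nullVector a y)) = 0 := by
      rw [← Kerr.bilin_nullVector]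
      exact coerSym_minkowski_skew_self hA _
    rw [h1, h2, add_zero, mul_zero]
  · -- both sides are bilinear forms; compare them on the coordinate basis
    set B₁ : E4 →L[ℝ] E4 →L[ℝ] ℝ := fderiv ℝ (Kerr.bilin M a) y Z +
      (Kerr.bilin M a y).bilinearComp A (ContinuousLinearMap.id ℝ E4) +
      (Kerr.bilin M a y).bilinearComp (ContinuousLinearMap.id ℝ E4) A with hB₁
    set B₂ : E4 →L[ℝ] E4 →L[ℝ] ℝ :=
      (Kerr.nullCovector a y).smulRight m + m.smulRight (Kerr.nullCovector a y) with hB₂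
    have hB₁apply : ∀ v w, B₁ v w = fderiv ℝ (Kerr.bilin M a) y Z v w +
        Kerr.bilin M a y (A v) w + Kerr.bilin M a y v (A w) := by
      intro v w
      simp only [hB₁, add_apply, ContinuousLinearMap.bilinearComp_apply,
        ContinuousLinearMap.id_apply]
    have hB₂apply : ∀ v w, B₂ v w =
        Kerr.nullCovector a y v * m w + m v * Kerr.nullCovector a y w := by
      intro v w
      simp only [hB₂, add_apply, ContinuousLinearMap.smulRight_apply,
        FunLike.coe_smul, Pi.smul_apply, smul_eq_mul]
    have hbasis : ∀ μ ν, B₁ (E4.basisVector μ) (E4.basisVector ν) =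
        B₂ (E4.basisVector μ) (E4.basisVector ν) := by
      intro μ ν
      have hsk := hA (E4.basisVector μ) (E4.basisVector ν)
      rw [hB₁apply, hB₂apply, Kerr.fderiv_bilin_basisVector M a hy Z μ ν, Kerr.bilin_apply,
        Kerr.bilin_apply, hmapply, hmapply]
      simp only [Kerr.nullCovector_basisVector, coerSym_covector_basisVector, hdℓ]
      linear_combination hsk
    rw [← hB₁apply, ← hB₂apply, ← Kerr.sum_sum_mul_bilin_basisVector B₁ v w,
      ← Kerr.sum_sum_mul_bilin_basisVector B₂ v w]
    exact Finset.sum_congr rfl fun μ _ ↦ Finset.sum_congr rfl fun ν _ ↦ by rw [hbasis]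

end NullPair

/-! ### Lab raising of the boosted null covector, every spin -/

section Lab

variable {Λ : lorentzGroup} {c : E4} {M a : ℝ} {x : E4}

/-- The boosted summand is invertible at a lab point with rest-frame radius `> 0`, every spin
(`isMetricOn_kerr_bilin` pulled back along `x ↦ Λ⁻¹(x − c)`). [cite: KerrSchild1965, §2] -/
theorem coerSym_isInvertible_boostedKerrBilin (hx : 0 < Kerr.radius a (poincareInv Λ c x)) :
    (boostedKerrBilin Λ c M a x).IsInvertible := by
  have hx' : x ∈ poincareInv Λ c ⁻¹' (Kerr.region a 0 : Set E4) := by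
    show poincareInv Λ c x ∈ (Kerr.region a 0 : Set E4)
    rw [SetLike.mem_coe, Kerr.mem_region, max_self]
    exact hx
  have hmet := (isMetricOn_kerr_bilin M a).isMetricOn_pullMetric (isCoordChangeOn_poincareInv Λ c a)
  rw [pullMetric_kerr_bilin_poincareInv] at hmet
  exact hmet.isInvertible x hx'

/-- **Lab raising of the boosted null covector, every spin**: `♯_{G₀(x)} (ℓ ∘ Λ⁻¹) = Λ ℓ♯`,
`G₀ = boostedKerrBilin Λ c M a`, `ℓ` the null covector at the rest image `Λ⁻¹(x − c)`.
[cite: KerrSchild1965, §2] -/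
theorem coerSym_sharpAt_boosted_ellLab (hx : 0 < Kerr.radius a (poincareInv Λ c x)) :
    sharpAt (boostedKerrBilin Λ c M a) x
        ((Kerr.nullCovector a (poincareInv Λ c x)).comp (((Λ : E4 ≃L[ℝ] E4).symm : E4 →L[ℝ] E4))) =
      ((Λ : E4 ≃L[ℝ] E4) : E4 →L[ℝ] E4) (Kerr.nullVector a (poincareInv Λ c x)) := by
  refine sharpAt_eq_of_forall (coerSym_isInvertible_boostedKerrBilin hx) fun w ↦ ?_
  rw [boostedKerrBilin_apply, ContinuousLinearMap.comp_apply, ContinuousLinearEquiv.coe_coe,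
    ContinuousLinearEquiv.coe_coe, ContinuousLinearEquiv.symm_apply_apply,
    bilin_nullVector_left M a hx]

end Lab

/-! ### Vanishing symbol rows at one lab event kill the rest-frame first variation -/

section OneEvent

variable {Λ : lorentzGroup} {c : E4} {M a : ℝ} {x : E4}

/-- **Kernel at one lab event, every spin.** Let `y = Λ⁻¹(x − c)` have `r(y) > 0`, `A` be `η`-skew,
`d ∈ E4`, `V` the lab first-variation form `V(v,w) = [∂_{Ay+d} g + g(A·,·) + g(·,A·)](Λ⁻¹v, Λ⁻¹w)`
and `S = ♯_{G₀(x)}`, `G₀ = boostedKerrBilin Λ c M a`. If for some real `τ` and all `Y, Z`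
`dx⁰(Z) dx⁰(S V(·,Y)) + dx⁰(Y) V(S dx⁰, Z) − dx⁰(S dx⁰) V(Y,Z) − τ dx⁰(Y) dx⁰(Z) = 0` (twice the
principal-symbol term of `ricAt_apply_eq_add_symbol_of_jets`, any trace coefficient), then the
rest-frame first variation vanishes at `y`: `V` is the lab null pair `(ℓ∘Λ⁻¹) ⊙ (m∘Λ⁻¹)`
(`coerSym_lieForm_nullPair`), `S(ℓ∘Λ⁻¹) = Λℓ♯` has `dx⁰ ≠ 0`, and the kernel lemma
`eq_zero_of_symbol_nullPair_eq_zero` gives `m = 0`. [cite: KerrSchild1965, §2] -/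
theorem coerSym_lieForm_eq_zero_of_symbol_eq_zero (hx : 0 < Kerr.radius a (poincareInv Λ c x))
    {A : E4 →L[ℝ] E4} (hA : ∀ u w : E4, Minkowski.bilin (A u) w + Minkowski.bilin u (A w) = 0)
    (d : E4) (V : E4 →L[ℝ] E4 →L[ℝ] ℝ)
    (hV : ∀ v w : E4, V v w =
      fderiv ℝ (Kerr.bilin M a) (poincareInv Λ c x) (A (poincareInv Λ c x) + d)
          ((((Λ : E4 ≃L[ℝ] E4).symm : E4 →L[ℝ] E4)) v) ((((Λ : E4 ≃L[ℝ] E4).symm : E4 →L[ℝ] E4)) w)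
        + Kerr.bilin M a (poincareInv Λ c x) (A ((((Λ : E4 ≃L[ℝ] E4).symm : E4 →L[ℝ] E4)) v))
          ((((Λ : E4 ≃L[ℝ] E4).symm : E4 →L[ℝ] E4)) w)
        + Kerr.bilin M a (poincareInv Λ c x) ((((Λ : E4 ≃L[ℝ] E4).symm : E4 →L[ℝ] E4)) v)
          (A ((((Λ : E4 ≃L[ℝ] E4).symm : E4 →L[ℝ] E4)) w)))
    (τ : ℝ)
    (hσ : ∀ Y Z : E4, E4.dx 0 Z * E4.dx 0 ((boostedKerrBilin Λ c M a x).inverse (V.flip Y))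
        + E4.dx 0 Y * V ((boostedKerrBilin Λ c M a x).inverse (E4.dx 0)) Z
        - E4.dx 0 ((boostedKerrBilin Λ c M a x).inverse (E4.dx 0)) * V Y Z
        - E4.dx 0 Y * E4.dx 0 Z * τ = 0)
    (v w : E4) :
    fderiv ℝ (Kerr.bilin M a) (poincareInv Λ c x) (A (poincareInv Λ c x) + d) v w
      + Kerr.bilin M a (poincareInv Λ c x) (A v) w
      + Kerr.bilin M a (poincareInv Λ c x) v (A w) = 0 := by
  set y : E4 := poincareInv Λ c x with hy
  set Li : E4 →L[ℝ] E4 := (((Λ : E4 ≃L[ℝ] E4).symm : E4 →L[ℝ] E4)) with hLi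
  set L : E4 →L[ℝ] E4 := ((Λ : E4 ≃L[ℝ] E4) : E4 →L[ℝ] E4) with hL
  obtain ⟨m, hmℓ0, hpair0⟩ := coerSym_lieForm_nullPair M a hx hA d
  set ℓlab : E4 →L[ℝ] ℝ := (Kerr.nullCovector a y).comp Li with hℓlab
  set mlab : E4 →L[ℝ] ℝ := m.comp Li with hmlab
  have hpair : ∀ v w : E4, V v w = ℓlab v * mlab w + mlab v * ℓlab w := by
    intro v w
    rw [hV v w, hpair0]
    simp only [hℓlab, hmlab, ContinuousLinearMap.comp_apply]
  set Sh : (E4 →L[ℝ] ℝ) →L[ℝ] E4 := (boostedKerrBilin Λ c M a x).inverse with hSh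
  have hSh' : Sh = sharpAt (boostedKerrBilin Λ c M a) x := rfl
  have hSℓ : Sh ℓlab = L (Kerr.nullVector a y) := by
    rw [hSh', hℓlab, hLi, hy, hL]; exact coerSym_sharpAt_boosted_ellLab hx
  have hinv : (boostedKerrBilin Λ c M a x).IsInvertible := coerSym_isInvertible_boostedKerrBilin hx
  have hℓℓ : ℓlab (Sh ℓlab) = 0 := by
    rw [hSℓ, hℓlab, ContinuousLinearMap.comp_apply, hLi, hL, ContinuousLinearEquiv.coe_coe,
      ContinuousLinearEquiv.coe_coe, ContinuousLinearEquiv.symm_apply_apply]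
    exact Kerr.nullCovector_nullVector hx
  have hmℓ : mlab (Sh ℓlab) = 0 := by
    rw [hSℓ, hmlab, ContinuousLinearMap.comp_apply, hLi, hL, ContinuousLinearEquiv.coe_coe,
      ContinuousLinearEquiv.coe_coe, ContinuousLinearEquiv.symm_apply_apply]
    exact hmℓ0
  have hζℓ : E4.dx 0 (Sh ℓlab) ≠ 0 := by
    rw [hSℓ, dx_zero_apply, hL]
    exact boostedNull_apply_zero_ne_zero Λ c a x hx
  have hℓζ : ℓlab (Sh (E4.dx 0)) ≠ 0 := by
    have h1 : ℓlab (Sh (E4.dx 0)) = E4.dx 0 (Sh ℓlab) := by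
      rw [hSh', ← apply_sharpAt_apply hinv ℓlab (sharpAt _ x (E4.dx 0)),
        boostedKerrBilin_symm, apply_sharpAt_apply hinv]
    rw [h1]; exact hζℓ
  have hm0 : mlab = 0 := by
    refine eq_zero_of_symbol_nullPair_eq_zero Sh (E4.dx 0) ℓlab mlab (E4.dx 0 (Sh (E4.dx 0))) τ
      hℓℓ hmℓ hζℓ hℓζ fun Y Z ↦ ?_
    have hflip : V.flip Y = ℓlab Y • mlab + mlab Y • ℓlab := by
      ext u
      rw [ContinuousLinearMap.flip_apply, hpair]
      simp only [add_apply, FunLike.coe_smul, Pi.smul_apply,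
        smul_eq_mul]
      ring
    have h := hσ Y Z
    rw [hflip, hpair (Sh (E4.dx 0)) Z, hpair Y Z] at h
    linear_combination h
  have hmzero : ∀ u : E4, m u = 0 := by
    intro u
    have h1 : mlab (L u) = 0 := by rw [hm0]; rfl
    rwa [hmlab, ContinuousLinearMap.comp_apply, hLi, hL, ContinuousLinearEquiv.coe_coe,
      ContinuousLinearEquiv.coe_coe, ContinuousLinearEquiv.symm_apply_apply] at h1
  rw [hpair0, hmzero v, hmzero w, mul_zero, zero_mul, add_zero]

end OneEvent

/-! ### Vanishing symbol rows at the three lab axis events force the stabiliser -/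

section Axis

variable {Λ : lorentzGroup} {M a : ℝ}

/-- The rest image of the lab event `Λ P` (centre `0`) is `P`. [folklore] -/
theorem coerSym_poincareInv_apply (Λ : lorentzGroup) (P : E4) :
    poincareInv Λ 0 ((Λ : E4 ≃L[ℝ] E4) P) = P := by
  simp [poincareInv]

/-- **Kernel at the three lab axis events, every spin.** Let `M ≠ 0`, `A` `η`-skew, `d ∈ E4`,
`0 < z`, `3|a| ≤ z`, `|v₃| < 1`, and `P₁ = (−v₃z,0,0,z)`, `P₂ = (−2v₃z,0,0,2z)`, `P₃ = (v₃z,0,0,−z)` the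
rest axis points of `axisKernel_slab`. Let `Φ x` be the lab first-variation form at the lab event `x`
(`Φ x (v,w) = [∂_{AΛ⁻¹x+d} g + g(A·,·) + g(·,A·)](Λ⁻¹v, Λ⁻¹w)` at `Λ⁻¹x`) and `K x = boostedKerrBilin Λ 0 M a x`.
If at each lab event `x = Λ P_k` the principal-symbol rows vanish,
`dx⁰(Z) dx⁰(♯_K Φ(·,Y)) + dx⁰(Y) Φ(♯_K dx⁰, Z) − dx⁰(♯_K dx⁰) Φ(Y,Z) − τ dx⁰(Y)dx⁰(Z) = 0` for some `τ`
and all `Y, Z`, then `A e₀ = 0`, `d¹ = d² = d³ = 0`, and `a ≠ 0 → A e₃ = 0`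
(`coerSym_lieForm_eq_zero_of_symbol_eq_zero` at each event, then `axisKernel_slab`). [folklore] -/
theorem coerSym_axisKernel_of_symbol (hM : M ≠ 0) {A : E4 →L[ℝ] E4}
    (hA : ∀ u w : E4, Minkowski.bilin (A u) w + Minkowski.bilin u (A w) = 0) (d : E4)
    {z v₃ : ℝ} (hz : 0 < z) (hza : 3 * |a| ≤ z) (hv : |v₃| < 1)
    (P₁ P₂ P₃ : E4) (hP₁ : P₁ = ![-(v₃ * z), 0, 0, z]) (hP₂ : P₂ = ![-(v₃ * (2 * z)), 0, 0, 2 * z])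
    (hP₃ : P₃ = ![v₃ * z, 0, 0, -z])
    (Φ K : E4 → E4 →L[ℝ] E4 →L[ℝ] ℝ)
    (hΦ : ∀ x v w : E4, Φ x v w =
      fderiv ℝ (Kerr.bilin M a) ((((Λ : E4 ≃L[ℝ] E4).symm : E4 →L[ℝ] E4)) x)
          (A ((((Λ : E4 ≃L[ℝ] E4).symm : E4 →L[ℝ] E4)) x) + d)
          ((((Λ : E4 ≃L[ℝ] E4).symm : E4 →L[ℝ] E4)) v) ((((Λ : E4 ≃L[ℝ] E4).symm : E4 →L[ℝ] E4)) w)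
        + Kerr.bilin M a ((((Λ : E4 ≃L[ℝ] E4).symm : E4 →L[ℝ] E4)) x)
          (A ((((Λ : E4 ≃L[ℝ] E4).symm : E4 →L[ℝ] E4)) v)) ((((Λ : E4 ≃L[ℝ] E4).symm : E4 →L[ℝ] E4)) w)
        + Kerr.bilin M a ((((Λ : E4 ≃L[ℝ] E4).symm : E4 →L[ℝ] E4)) x)
          ((((Λ : E4 ≃L[ℝ] E4).symm : E4 →L[ℝ] E4)) v) (A ((((Λ : E4 ≃L[ℝ] E4).symm : E4 →L[ℝ] E4)) w)))
    (hK : ∀ x, K x = boostedKerrBilin Λ 0 M a x)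
    (h : ∀ P ∈ ({P₁, P₂, P₃} : Set E4), ∃ τ : ℝ, ∀ Y Z : E4,
      E4.dx 0 Z * E4.dx 0 ((K ((Λ : E4 ≃L[ℝ] E4) P)).inverse ((Φ ((Λ : E4 ≃L[ℝ] E4) P)).flip Y))
        + E4.dx 0 Y * Φ ((Λ : E4 ≃L[ℝ] E4) P) ((K ((Λ : E4 ≃L[ℝ] E4) P)).inverse (E4.dx 0)) Z
        - E4.dx 0 ((K ((Λ : E4 ≃L[ℝ] E4) P)).inverse (E4.dx 0)) * Φ ((Λ : E4 ≃L[ℝ] E4) P) Y Z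
        - E4.dx 0 Y * E4.dx 0 Z * τ = 0) :
    A (E4.basisVector 0) = 0 ∧ d 1 = 0 ∧ d 2 = 0 ∧ d 3 = 0 ∧ (a ≠ 0 → A (E4.basisVector 3) = 0) := by
  refine axisKernel_slab A d hM hA hz hza hv P₁ P₂ P₃ hP₁ hP₂ hP₃ fun P hP ν ↦ ?_
  have hP' : P 1 = 0 ∧ P 2 = 0 ∧ P 3 ≠ 0 := by
    simp only [Set.mem_insert_iff, Set.mem_singleton_iff] at hP
    have hz0 : z ≠ 0 := hz.ne'
    rcases hP with rfl | rfl | rfl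
    · simp only [hP₁]; simpa using hz0
    · simp only [hP₂]; simpa using hz0
    · simp only [hP₃]; simpa using hz0
  obtain ⟨hP1, hP2, hP3⟩ := hP'
  have hrad : 0 < Kerr.radius a P := axis_radius_pos (a := a) hP1 hP2 hP3
  set x : E4 := (Λ : E4 ≃L[ℝ] E4) P with hxdef
  have hyx : poincareInv Λ 0 x = P := coerSym_poincareInv_apply Λ P
  have hSx : (((Λ : E4 ≃L[ℝ] E4).symm : E4 →L[ℝ] E4)) x = P := by
    rw [hxdef, ContinuousLinearEquiv.coe_coe, ContinuousLinearEquiv.symm_apply_apply]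
  have hradx : 0 < Kerr.radius a (poincareInv Λ 0 x) := by rwa [hyx]
  obtain ⟨τ, hτ⟩ := h P hP
  have key := coerSym_lieForm_eq_zero_of_symbol_eq_zero (M := M) hradx hA d (Φ x)
    (fun v w ↦ by rw [hΦ, hSx, hyx]) τ (by simpa only [hK] using hτ)
    (E4.basisVector 0) (E4.basisVector ν)
  rwa [hyx] at key

end Axis

/-- **Registered one-line carrier form** (`coerSym_nullPair_cs`, sub-goal of the crux item) of `coerSym_lieForm_nullPair`: the first variation of the Kerr–Schild form under an infinitesimal Poincaré motion is a null pair, every spin. [cite: KerrSchild1965, §2] -/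
theorem coerSym_nullPair_cs : open Literature.Geometry.Lorentzian in ∀ (M a : ℝ) {y : E4}, 0 < Kerr.radius a y → ∀ {A : E4 →L[ℝ] E4}, (∀ u w : E4, Minkowski.bilin (A u) w + Minkowski.bilin u (A w) = 0) → ∀ (d : E4), ∃ m : E4 →L[ℝ] ℝ, m (Kerr.nullVector a y) = 0 ∧ ∀ v w : E4, fderiv ℝ (Kerr.bilin M a) y (A y + d) v w + Kerr.bilin M a y (A v) w + Kerr.bilin M a y v (A w) = Kerr.nullCovector a y v * m w + m v * Kerr.nullCovector a y w :=
  fun M a _ hy _ hA d ↦ coerSym_lieForm_nullPair M a hy hA d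

end Summit.FinalStateConjecture.FinalStateConjecture.Theorems.SublinearIsFree.Slaving

end
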